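import Summits.CriticalPhenomena.PercolationContinuityZ3.Theorems.FK.InfiniteVolumeDLRJoinGraph
import Summits.CriticalPhenomena.PercolationContinuityZ3.Theorems.FK.InfiniteVolumeDLRPowersetTilt
import Mathlib.Combinatorics.SetFamily.FourFunctions
import HarnessLib

/-!
# FK-continuity transplant, FO-06/FO-10 (infinite-volume structure): the specification kernel `φ^ξ_{Λ,p,q}` is
# POSITIVELY ASSOCIATED for every boundary condition `ξ` — Grimmett 2006, Lemma (4.13) with Thm. (3.8)(b), coupling-free

Registered R87 (cell INBOX l.6278, 2026-08-24); registry row FO-10b-g408; label DPA-A (coordinator fk-4 g192).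
Cell `fk-continuity` (bschramm), FO-10b lineage; support file for the FK-continuity transplant
(`--supports stmt-CriticalPhenomena-4575`); builds on p205010 (kernel theorem, internal audit signed; external expert
review pending). No named facts, no definitions, no sorries, standard axioms. Banked infinite-volume structure; not an
END-STATE dependency of the cell (not consumed by `_r3`); it says nothing about FH / TP_FK or continuity at `p_c`.

For `0 ≤ p ≤ 1`, `q ≥ 1`, a finite region `Λ`, ANY configuration `ξ` (an arbitrary set of pairs) and increasing
events `A`, `B` (read on the patterns `η ⊆ E_Λ` through `↑η ∈ A`):

* `powerset_fkg_sum_mul_sum_le` — the FKG inequality on the powerset of any finite edge set `U` for the weights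
  `w_k(η) = p^{|η|} (1-p)^{|U ∖ η|} q^{k(η)}` with `k` supermodular: `(∑ w_k f)(∑ w_k g) ≤ (∑ w_k)(∑ w_k f g)` for
  nonnegative monotone `f, g` (Thm. (3.8)(b) via Ahlswede–Daykin, Mathlib `Finset.four_functions_theorem`);
* **`sum_ite_rcCondProb_mul_sum_le`** — positive association of the kernel:
  `(∑_{η ∈ A} φ^ξ_{Λ,p,q}(η)) · (∑_{η ∈ B} φ^ξ_{Λ,p,q}(η)) ≤ ∑_{η ∈ A ∩ B} φ^ξ_{Λ,p,q}(η)` (Lemma (4.13): the kernel is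
  the random-cluster measure on `(Λ, E_Λ)` with the boundary-condition graph `R_ξ` of `InfiniteVolumeDLRJoinGraph.lean`,
  whose cluster count is supermodular in `η`).

## References

* G. Grimmett, *The Random-Cluster Model*, Springer 2006: Thm. (3.8)(b) eq. (3.12), Lemma (4.13), Thm. (4.17)(a).
  [Grimmett2006]
-/

noncomputable section

open Finset MeasureTheory

namespace Summit.CriticalPhenomena.PercolationContinuityZ3.Theorems.FK

open Literature.Probability.Percolation Literature.Probability.LatticeModels

section Powerset

variable {ι : Type*} [DecidableEq ι]

/-- **FKG on the powerset for random-cluster-type weights** (Grimmett 2006, Thm. (3.8)(b)): for `0 ≤ p ≤ 1`,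
`q ≥ 1`, a finite edge set `U`, an exponent `k` supermodular on the subsets of `U`, and nonnegative monotone `f, g`,
the weights `w(η) = p^{|η|}(1-p)^{|U ∖ η|} q^{k(η)}` satisfy `(∑_{η ⊆ U} w f)(∑_{η ⊆ U} w g) ≤ (∑ w)(∑ w f g)`
(Ahlswede–Daykin with `f₁ = w f`, `f₂ = w g`, `f₃ = w`, `f₄ = w f g`). [cite: Grimmett2006, Thm. (3.8)(b)] -/
theorem powerset_fkg_sum_mul_sum_le (U : Finset ι) {p q : ℝ} (hp : p ∈ Set.Icc (0 : ℝ) 1) (hq : 1 ≤ q)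
    (k : Finset ι → ℕ) (hk : ∀ ⦃a⦄, a ⊆ U → ∀ ⦃b⦄, b ⊆ U → k a + k b ≤ k (a ∩ b) + k (a ∪ b))
    {f g : Finset ι → ℝ} (hf0 : ∀ η, 0 ≤ f η) (hf : Monotone f) (hg0 : ∀ η, 0 ≤ g η) (hg : Monotone g) :
    (∑ η ∈ U.powerset, p ^ η.card * (1 - p) ^ (U \ η).card * q ^ k η * f η) *
      (∑ η ∈ U.powerset, p ^ η.card * (1 - p) ^ (U \ η).card * q ^ k η * g η) ≤
    (∑ η ∈ U.powerset, p ^ η.card * (1 - p) ^ (U \ η).card * q ^ k η) *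
      (∑ η ∈ U.powerset, p ^ η.card * (1 - p) ^ (U \ η).card * q ^ k η * (f η * g η)) := by
  classical
  have h0p : 0 ≤ p := hp.1
  have h1p : 0 ≤ 1 - p := sub_nonneg.2 hp.2
  have hq0 : 0 ≤ q := zero_le_one.trans hq
  set w : Finset ι → ℝ := fun η => p ^ η.card * (1 - p) ^ (U \ η).card * q ^ k η with hw
  have hw0 : ∀ η, 0 ≤ w η := fun η => by simp only [hw]; positivity
  have hcond : ∀ ⦃s⦄, s ⊆ U → ∀ ⦃t⦄, t ⊆ U →
      (fun η => w η * f η) s * (fun η => w η * g η) t ≤ w (s ∩ t) * (fun η => w η * (f η * g η)) (s ∪ t) := by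
    intro s hs t ht
    dsimp only
    have hcard : s.card + t.card = (s ∩ t).card + (s ∪ t).card := by
      rw [add_comm (s ∩ t).card, Finset.card_union_add_card_inter]
    have hcard' : (U \ s).card + (U \ t).card = (U \ (s ∩ t)).card + (U \ (s ∪ t)).card := by
      rw [sdiff_inter_distrib_right, Finset.sdiff_union_distrib, Finset.card_union_add_card_inter]
    have hexp : k s + k t ≤ k (s ∩ t) + k (s ∪ t) := hk hs ht
    have hww : w s * w t ≤ w (s ∩ t) * w (s ∪ t) := by
      simp only [hw]
      calc p ^ s.card * (1 - p) ^ (U \ s).card * q ^ k s * (p ^ t.card * (1 - p) ^ (U \ t).card * q ^ k t)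
          = p ^ (s.card + t.card) * (1 - p) ^ ((U \ s).card + (U \ t).card) * q ^ (k s + k t) := by
            simp only [pow_add]; ring
        _ ≤ p ^ (s.card + t.card) * (1 - p) ^ ((U \ s).card + (U \ t).card) * q ^ (k (s ∩ t) + k (s ∪ t)) := by
            gcongr
        _ = p ^ ((s ∩ t).card + (s ∪ t).card) * (1 - p) ^ ((U \ (s ∩ t)).card + (U \ (s ∪ t)).card) *
              q ^ (k (s ∩ t) + k (s ∪ t)) := by rw [hcard, hcard']
        _ = _ := by simp only [pow_add]; ring
    have hfs : f s ≤ f (s ∪ t) := hf Finset.subset_union_left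
    have hgt : g t ≤ g (s ∪ t) := hg Finset.subset_union_right
    have hfg : f s * g t ≤ f (s ∪ t) * g (s ∪ t) := mul_le_mul hfs hgt (hg0 t) (hf0 _)
    calc w s * f s * (w t * g t) = (w s * w t) * (f s * g t) := by ring
      _ ≤ (w (s ∩ t) * w (s ∪ t)) * (f (s ∪ t) * g (s ∪ t)) :=
          mul_le_mul hww hfg (mul_nonneg (hf0 s) (hg0 t)) (mul_nonneg (hw0 _) (hw0 _))
      _ = w (s ∩ t) * (w (s ∪ t) * (f (s ∪ t) * g (s ∪ t))) := by ring
  have key := Finset.four_functions_theorem U (f₁ := fun η => w η * f η) (f₂ := fun η => w η * g η) (f₃ := w)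
    (f₄ := fun η => w η * (f η * g η)) (fun η => mul_nonneg (hw0 η) (hf0 η)) (fun η => mul_nonneg (hw0 η) (hg0 η))
    (fun η => hw0 η) (fun η => mul_nonneg (hw0 η) (mul_nonneg (hf0 η) (hg0 η))) hcond (subset_refl U.powerset)
    (subset_refl U.powerset)
  simpa only [Finset.powerset_infs_powerset_self, Finset.powerset_sups_powerset_self, hw] using key

end Powerset

section Kernel

variable {d : ℕ} {p q : ℝ}

/-- **The specification kernel is positively associated** (Grimmett 2006, Lemma (4.13) with Thm. (3.8)(b), for
EVERY boundary condition `ξ`): for `0 ≤ p ≤ 1`, `q ≥ 1`, a finite region `Λ` and increasing events `A`, `B`,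
`(∑_{η ∈ A} φ^ξ_{Λ,p,q}(η)) · (∑_{η ∈ B} φ^ξ_{Λ,p,q}(η)) ≤ ∑_{η ∈ A ∩ B} φ^ξ_{Λ,p,q}(η)`.
[cite: Grimmett2006, Lemma (4.13), Thm. (3.8)(b)] -/
theorem sum_ite_rcCondProb_mul_sum_le (hp : p ∈ Set.Icc (0 : ℝ) 1) (hq : 1 ≤ q) (Λ : Finset (Site d))
    (ξ : BondConfig (Site d)) {A B : Set (BondConfig (Site d))} [DecidablePred (· ∈ A)] [DecidablePred (· ∈ B)]
    (hA : IsUpperSet A) (hB : IsUpperSet B) :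
    (∑ η ∈ (edgesIn (zdGraph d) Λ).powerset, (if (↑η : BondConfig (Site d)) ∈ A then rcCondProb p q Λ ξ η else 0)) *
      (∑ η ∈ (edgesIn (zdGraph d) Λ).powerset,
        (if (↑η : BondConfig (Site d)) ∈ B then rcCondProb p q Λ ξ η else 0)) ≤
      ∑ η ∈ (edgesIn (zdGraph d) Λ).powerset,
        (if (↑η : BondConfig (Site d)) ∈ A ∩ B then rcCondProb p q Λ ξ η else 0) := by
  classical
  have hq0 : 0 < q := one_pos.trans_le hq
  set U := edgesIn (zdGraph d) Λ with hU
  set R : SimpleGraph (↑Λ : Set (Site d)) :=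
    (SimpleGraph.fromRel (openGraph (ξ \ ↑U)).Reachable).comap (Subtype.val : (↑Λ : Set (Site d)) → Site d) with hR
  set k : Finset (Sym2 (Site d)) → ℕ := fun η =>
    Nat.card ((openGraph (↑η : BondConfig (Site d))).comap (Subtype.val : (↑Λ : Set (Site d)) → Site d) ⊔
      R).ConnectedComponent with hk
  set f : Finset (Sym2 (Site d)) → ℝ := fun η => if (↑η : BondConfig (Site d)) ∈ A then 1 else 0 with hf
  set g : Finset (Sym2 (Site d)) → ℝ := fun η => if (↑η : BondConfig (Site d)) ∈ B then 1 else 0 with hg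
  have hf0 : ∀ η, 0 ≤ f η := fun η => by simp only [hf]; split_ifs <;> norm_num
  have hg0 : ∀ η, 0 ≤ g η := fun η => by simp only [hg]; split_ifs <;> norm_num
  have hmono : ∀ {C : Set (BondConfig (Site d))} [DecidablePred (· ∈ C)], IsUpperSet C →
      Monotone fun η : Finset (Sym2 (Site d)) => if (↑η : BondConfig (Site d)) ∈ C then (1 : ℝ) else 0 := by
    intro C _ hC a b hab
    dsimp only
    by_cases ha : (↑a : BondConfig (Site d)) ∈ C
    · rw [if_pos ha, if_pos (hC (Finset.coe_subset.2 hab) ha)]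
    · rw [if_neg ha]; split_ifs <;> norm_num
  have hfg : ∀ η, f η * g η = if (↑η : BondConfig (Site d)) ∈ A ∩ B then 1 else 0 := by
    intro η
    simp only [hf, hg]
    by_cases ha : (↑η : BondConfig (Site d)) ∈ A <;> by_cases hb : (↑η : BondConfig (Site d)) ∈ B <;>
      simp [ha, hb, Set.mem_inter_iff]
  have hfkg := powerset_fkg_sum_mul_sum_le U hp hq k
    (fun a _ b _ => card_cc_comap_sup_supermodular Subtype.val R a b) hf0 (hmono hA) hg0 (hmono hB)
  set Z := ∑ η ∈ U.powerset, p ^ η.card * (1 - p) ^ (U \ η).card * q ^ k η with hZ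
  have hZeq : Z = rcCondPartition p q Λ ξ := by
    rw [rcCondPartition_eq]
    refine Finset.sum_congr rfl fun η hη => ?_
    rw [rcCondWeight_eq_pow_card_comap p q Λ ξ (Finset.mem_powerset.1 hη)]
  have hZpos : 0 < Z := by rw [hZeq]; exact rcCondPartition_pos hp hq0 Λ ξ
  -- the three kernel sums as weighted sums divided by `Z`
  have hker : ∀ (h : Finset (Sym2 (Site d)) → ℝ) (C : Set (BondConfig (Site d))) [DecidablePred (· ∈ C)],
      (∀ η, h η = if (↑η : BondConfig (Site d)) ∈ C then 1 else 0) →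
      ∑ η ∈ U.powerset, (if (↑η : BondConfig (Site d)) ∈ C then rcCondProb p q Λ ξ η else 0) =
        (∑ η ∈ U.powerset, p ^ η.card * (1 - p) ^ (U \ η).card * q ^ k η * h η) / Z := by
    intro h C _ hh
    rw [Finset.sum_div]
    refine Finset.sum_congr rfl fun η hη => ?_
    rw [rcCondProb_eq, ← hZeq, rcCondWeight_eq_pow_card_comap p q Λ ξ (Finset.mem_powerset.1 hη), hh η]
    split_ifs
    · rw [mul_one]
    · rw [mul_zero, zero_div]
  rw [hker f A (fun η => rfl), hker g B (fun η => rfl), hker (fun η => f η * g η) (A ∩ B) hfg,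
    div_mul_div_comm, div_le_div_iff₀ (mul_pos hZpos hZpos) hZpos]
  calc (∑ η ∈ U.powerset, p ^ η.card * (1 - p) ^ (U \ η).card * q ^ k η * f η) *
        (∑ η ∈ U.powerset, p ^ η.card * (1 - p) ^ (U \ η).card * q ^ k η * g η) * Z
      ≤ (Z * ∑ η ∈ U.powerset, p ^ η.card * (1 - p) ^ (U \ η).card * q ^ k η * (f η * g η)) * Z :=
        mul_le_mul_of_nonneg_right hfkg hZpos.le
    _ = (∑ η ∈ U.powerset, p ^ η.card * (1 - p) ^ (U \ η).card * q ^ k η * (f η * g η)) * (Z * Z) := by ring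

end Kernel

end Summit.CriticalPhenomena.PercolationContinuityZ3.Theorems.FK

end
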